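import Mathlib
import HarnessLib
import Summits.Ventures.LatticeQCDFlow.Exactness.IMHAcceptanceGeESS

/-!
# LatticeQCDFlow / Scaling — the SHARP ESS floor of the overlap on a GENERAL measure space:
# `min(κ, 1/2) ≤ ∫ min(p, q) = 1 − TV(p, q)`, the `χ²` bound `(2·TV)² ≤ 1/κ − 1`, and the envelope

HONEST FRAMING: exact (Metropolis-corrected) sampling algorithms for lattice gauge theory;
figures of merit are autocorrelation/cost numbers at stated couplings and volumes; no
continuum-physics claim.

Venture `LatticeQCDFlow` (cell pub-lqcd), topic `Scaling`; FANOUT row 3 (`s0-u1-a`, S0-B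
implementation A, GEN-9).  NEW WORK of the cell, not a published result; NO definition is
introduced.  Measure-theoretic version of row 3's finite `Scaling/OverlapEssFloor.lean` (GEN-8;
listed there as NOT CLAIMED: "the measure-theoretic version (row 2's setting)"), in the setting and
vocabulary of row 2's `Exactness/IMHAcceptanceGeESS.lean` (imported; its floor is
`overlap_ge_of_weightMoment`: `m ≥ κ/(1 + κ)`, which `min(κ, 1/2)` dominates everywhere —
row 3's `div_one_add_le_min_half`).  The OVERLAP `m = ∫ min(p, q) dμ = 1 − ‖p − q‖_TV` is the
i.i.d.-resampling / maximal-coupling acceptance and squeezes the flow sampler's equilibrium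
acceptance (`m² ≤ ā ≤ m`, row 2's `FlowAcceptanceOverlap`).

## What is proved (`(X, μ)` any measure space; `p, q > 0` measurable integrable, `∫ p = 1`
## (`∫ q = 1` only where stated); `W = ∫ (p/q) p dμ = E_q[b²] = 1/κ`; `m = ∫ min(p, q) dμ`)

* **`min_inv_weightMoment_half_le_overlap`** — `min(1/W, 1/2) ≤ m` (no normalisation of `q`):
  if `m < 1/2`, on `U = {q < p}` with `y = ∫_U q`, `x = ∫_{Uᶜ} p` (`m = x + y`, `∫_U p = 1 − x`)
  the discriminant of `t ↦ ∫_U (p − tq)²/q ≥ 0` gives `W ≥ ∫_U p²/q ≥ (1 − x)²/y`, and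
  `(x + y)(1 − x)² − y = x(1 − m(2 − x)) ≥ 0`;
* **`four_mul_sq_one_sub_overlap_le`** — `4(1 − m)² ≤ W − 1` (`∫ q = 1`): `(2·TV)² ≤ χ²(p‖q)` by
  the discriminant of `t ↦ ∫ (|p − q| − tq)²/q` and `∫ |p − q| = 2(1 − m)`;
  `one_sub_half_sqrt_le_overlap` — `1 − ½√(W − 1) ≤ m`;
* **`overlap_envelope_integral`** — `max(min(1/W, 1/2), 1 − ½√(W − 1)) ≤ m`;
  **`phi4Flow_overlap_envelope`** — row 2's φ⁴ flow sampler (`p = e^{−S}/Z`).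

Sharpness of both pieces is finite already (row 3's `hitOrMiss_sum_min_eq_essFrac`,
`symmetricPair_overlap`, `exists_sum_min_lt_essFrac`), hence holds here.  NOT CLAIMED: anything
about the acceptance of the CHAIN (that is `Scaling/AcceptanceEssEightNinthsDensities`,
`Scaling/AcceptanceGiniFloorIntegral`); any number of ours; nothing re-scored.
-/

namespace Summit.Ventures.LatticeQCDFlow.Theory2

open MeasureTheory Set
open Summit.Ventures.LatticeQCDFlow.Exactness

section General

variable {X : Type*} [MeasurableSpace X] {μ : Measure X} {p q : X → ℝ}

/-- **`min(κ, 1/2) ≤ ∫ min(p, q) dμ`** for probability densities `p > 0` (`∫ p = 1`) and a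
positive integrable `q` (its normalisation is not used), `κ = 1/W`, `W = ∫ (p/q) p dμ = E_q[b²]`.
Proof: if `m = ∫ min(p,q) < 1/2`, on `U = {q < p}` put `y = ∫_U q`, `x = ∫_{Uᶜ} p`, so
`m = x + y`, `∫_U p = 1 − x`; the discriminant of `t ↦ ∫_U (p − tq)²/q ≥ 0` gives
`W ≥ ∫_U p²/q ≥ (1 − x)²/y`, and `(x + y)(1 − x)² − y = x(1 − m(2 − x)) ≥ 0`.  (Finite twin:
row 3's `min_essFrac_half_le_sum_min`; row 2's floor in this setting was `κ/(1 + κ)`,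
`overlap_ge_of_weightMoment`.) -/
theorem min_inv_weightMoment_half_le_overlap (hp0 : ∀ x, 0 < p x) (hpm : Measurable p)
    (hpi : Integrable p μ) (hp1 : ∫ x, p x ∂μ = 1) (hq0 : ∀ x, 0 < q x) (hqm : Measurable q)
    (hqi : Integrable q μ) (hW : Integrable (fun x => p x / q x * p x) μ) :
    min (1 / ∫ x, p x / q x * p x ∂μ) (1 / 2) ≤ ∫ x, min (p x) (q x) ∂μ := by
  set W : ℝ := ∫ x, p x / q x * p x ∂μ with hWdef
  set m : ℝ := ∫ x, min (p x) (q x) ∂μ with hmdef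
  have hm0 : 0 ≤ m := integral_nonneg fun x => le_min (hp0 x).le (hq0 x).le
  rcases le_or_gt (1 / 2) m with hm | hm
  · exact le_trans (min_le_right _ _) hm
  rcases le_or_gt W 0 with hWnp | hWpos
  · exact le_trans (min_le_left _ _) (le_trans (one_div_nonpos.2 hWnp) hm0)
  -- the set where the target exceeds the model
  set U : Set X := {x | q x < p x} with hUdef
  have hU : MeasurableSet U := measurableSet_lt hqm hpm
  set y : ℝ := ∫ x in U, q x ∂μ with hydef
  set x₀ : ℝ := ∫ x in Uᶜ, p x ∂μ with hx₀def
  set pU : ℝ := ∫ x in U, p x ∂μ with hpUdef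
  set KU : ℝ := ∫ x in U, p x / q x * p x ∂μ with hKUdef
  have hy0 : 0 ≤ y := setIntegral_nonneg hU fun x _ => (hq0 x).le
  have hx0 : 0 ≤ x₀ := setIntegral_nonneg hU.compl fun x _ => (hp0 x).le
  have hpU0 : 0 ≤ pU := setIntegral_nonneg hU fun x _ => (hp0 x).le
  -- `m = y + x₀`, `pU + x₀ = 1`, `KU ≤ W`
  have hmin : Integrable (fun x => min (p x) (q x)) μ := hpi.inf hqi
  have hm_split : m = y + x₀ := by
    rw [hmdef, ← integral_add_compl hU hmin]
    congr 1
    · exact setIntegral_congr_fun hU fun x hx => min_eq_right (le_of_lt hx)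
    · exact setIntegral_congr_fun hU.compl fun x hx => min_eq_left (not_lt.1 hx)
  have hp_split : pU + x₀ = 1 := by
    rw [hpUdef, hx₀def, integral_add_compl hU hpi, hp1]
  have hKU : KU ≤ W := setIntegral_le_integral hW (Filter.Eventually.of_forall fun x =>
    (mul_pos (div_pos (hp0 x) (hq0 x)) (hp0 x)).le)
  -- the discriminant on `U`: `0 ≤ ∫_U (p − tq)²/q = KU − 2t·pU + t²·y`
  have hquad : ∀ t : ℝ, 0 ≤ KU - 2 * t * pU + t ^ 2 * y := by
    intro t
    have hnn : 0 ≤ ∫ x in U, (p x - t * q x) ^ 2 / q x ∂μ :=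
      setIntegral_nonneg hU fun x _ => div_nonneg (sq_nonneg _) (hq0 x).le
    have e : ∀ x, (p x - t * q x) ^ 2 / q x = p x / q x * p x - (2 * t) * p x + t ^ 2 * q x := by
      intro x
      have := (hq0 x).ne'
      field_simp
      ring
    have h12 : Integrable (fun x => p x / q x * p x - (2 * t) * p x) (μ.restrict U) :=
      hW.integrableOn.sub (hpi.integrableOn.const_mul _)
    rw [setIntegral_congr_fun hU (fun x _ => e x), integral_add h12 (hqi.integrableOn.const_mul _),
      integral_sub hW.integrableOn (hpi.integrableOn.const_mul _), integral_const_mul,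
      integral_const_mul] at hnn
    linarith
  -- `y > 0` (else `pU = 0`, `x₀ = 1`, `m = 1`)
  have hypos : 0 < y := by
    rcases lt_or_eq_of_le hy0 with h | h
    · exact h
    · exfalso
      have h1 : pU ≤ 0 := by
        rcases le_or_gt pU 0 with hle | hcon
        · exact hle
        exfalso
        have := hquad ((KU + 1) / (2 * pU))
        rw [← h] at this
        have e : KU - 2 * ((KU + 1) / (2 * pU)) * pU + ((KU + 1) / (2 * pU)) ^ 2 * 0 = -1 := by
          field_simp
          ring
        linarith
      have : x₀ = 1 := by linarith
      linarith
  -- Cauchy–Schwarz on `U`: `pU² ≤ KU·y`, at `t = pU/y`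
  have hCS : pU ^ 2 ≤ KU * y := by
    have := hquad (pU / y)
    have e : KU - 2 * (pU / y) * pU + (pU / y) ^ 2 * y = KU - pU ^ 2 / y := by
      field_simp
      ring
    rw [e] at this
    have : pU ^ 2 / y ≤ KU := by linarith
    exact (div_le_iff₀ hypos).1 this
  -- conclude `1/W ≤ m`
  have hx₀1 : pU = 1 - x₀ := by linarith
  have key : y ≤ (x₀ + y) * (1 - x₀) ^ 2 := by
    have hmx : m = x₀ + y := by rw [hm_split]; ring
    nlinarith [mul_nonneg hx0 hy0, mul_nonneg hx0 hx0, hm, hmx]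
  have hWm : 1 ≤ W * m := by
    rw [hm_split]
    have h1 : (1 - x₀) ^ 2 * (x₀ + y) ≥ y := by linarith
    have h2 : W * y ≥ (1 - x₀) ^ 2 := by rw [← hx₀1]; nlinarith [hKU, hCS]
    nlinarith [h2, hx0, hy0, hWpos]
  calc min (1 / W) (1 / 2) ≤ 1 / W := min_le_left _ _
    _ ≤ m := by rw [div_le_iff₀ hWpos]; linarith [mul_comm W m]

/-- **The `χ²` bound on a general space**: `4(1 − m)² ≤ W − 1` for probability densities
`p, q > 0`, `m = ∫ min(p, q) = 1 − TV(p, q)`, `W = ∫ (p/q) p = 1 + χ²(p‖q) = 1/κ` — i.e.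
`(2·TV)² ≤ χ²`, by the discriminant of `t ↦ ∫ (|p − q| − tq)²/q ≥ 0` and `∫ |p − q| = 2(1 − m)`.
(Finite twin: `Scaling/Acceptance.sq_two_mul_tvDist_le`.) -/
theorem four_mul_sq_one_sub_overlap_le (hpi : Integrable p μ) (hp1 : ∫ x, p x ∂μ = 1)
    (hq0 : ∀ x, 0 < q x) (hqi : Integrable q μ) (hq1 : ∫ x, q x ∂μ = 1)
    (hW : Integrable (fun x => p x / q x * p x) μ) :
    4 * (1 - ∫ x, min (p x) (q x) ∂μ) ^ 2 ≤ (∫ x, p x / q x * p x ∂μ) - 1 := by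
  set W : ℝ := ∫ x, p x / q x * p x ∂μ with hWdef
  set m : ℝ := ∫ x, min (p x) (q x) ∂μ with hmdef
  have hmin : Integrable (fun x => min (p x) (q x)) μ := hpi.inf hqi
  have habs : Integrable (fun x => |p x - q x|) μ := (hpi.sub hqi).abs
  -- `∫ |p − q| = 2(1 − m)`
  have hL1 : ∫ x, |p x - q x| ∂μ = 2 * (1 - m) := by
    have e : ∀ x, |p x - q x| = p x + q x - 2 * min (p x) (q x) := by
      intro x
      rcases le_total (p x) (q x) with h | h
      · rw [min_eq_left h, abs_of_nonpos (by linarith)]; ring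
      · rw [min_eq_right h, abs_of_nonneg (by linarith)]; ring
    have h12 : Integrable (fun x => p x + q x) μ := hpi.add hqi
    rw [integral_congr_ae (Filter.Eventually.of_forall e), integral_sub h12 (hmin.const_mul _),
      integral_add hpi hqi, integral_const_mul, hp1, hq1]
    ring
  -- `∫ (p − q)²/q = W − 1`
  have hchi : ∫ x, (p x - q x) ^ 2 / q x ∂μ = W - 1 := by
    have e : ∀ x, (p x - q x) ^ 2 / q x = p x / q x * p x - 2 * p x + q x := by
      intro x
      have := (hq0 x).ne'
      field_simp
      ring
    have h12 : Integrable (fun x => p x / q x * p x - 2 * p x) μ := hW.sub (hpi.const_mul _)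
    rw [integral_congr_ae (Filter.Eventually.of_forall e), integral_add h12 hqi,
      integral_sub hW (hpi.const_mul _), integral_const_mul, hp1, hq1]
    ring
  have hchiI : Integrable (fun x => (p x - q x) ^ 2 / q x) μ := by
    have e : (fun x => (p x - q x) ^ 2 / q x) = fun x => p x / q x * p x - 2 * p x + q x := by
      funext x
      have := (hq0 x).ne'
      field_simp
      ring
    rw [e]
    exact (hW.sub (hpi.const_mul _)).add hqi
  -- discriminant at `t = 2(1 − m)`
  have hnn : 0 ≤ ∫ x, (|p x - q x| - 2 * (1 - m) * q x) ^ 2 / q x ∂μ :=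
    integral_nonneg fun x => div_nonneg (sq_nonneg _) (hq0 x).le
  have e : ∀ x, (|p x - q x| - 2 * (1 - m) * q x) ^ 2 / q x
      = (p x - q x) ^ 2 / q x - (4 * (1 - m)) * |p x - q x| + (4 * (1 - m) ^ 2) * q x := by
    intro x
    have := (hq0 x).ne'
    have hsq : |p x - q x| ^ 2 = (p x - q x) ^ 2 := sq_abs _
    field_simp
    ring_nf
    rw [hsq]
    ring
  have h12 : Integrable (fun x => (p x - q x) ^ 2 / q x - (4 * (1 - m)) * |p x - q x|) μ :=
    hchiI.sub (habs.const_mul _)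
  rw [integral_congr_ae (Filter.Eventually.of_forall e), integral_add h12 (hqi.const_mul _),
    integral_sub hchiI (habs.const_mul _), integral_const_mul, integral_const_mul, hchi, hL1,
    hq1] at hnn
  nlinarith

/-- **`1 − ½√(W − 1) ≤ ∫ min(p, q)`** (`W = 1/κ`): the `χ²` piece of the overlap envelope. -/
theorem one_sub_half_sqrt_le_overlap (hpi : Integrable p μ) (hp1 : ∫ x, p x ∂μ = 1)
    (hq0 : ∀ x, 0 < q x) (hqi : Integrable q μ) (hq1 : ∫ x, q x ∂μ = 1)
    (hW : Integrable (fun x => p x / q x * p x) μ) :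
    1 - Real.sqrt ((∫ x, p x / q x * p x ∂μ) - 1) / 2 ≤ ∫ x, min (p x) (q x) ∂μ := by
  have h := four_mul_sq_one_sub_overlap_le hpi hp1 hq0 hqi hq1 hW
  set m : ℝ := ∫ x, min (p x) (q x) ∂μ
  have h1 : 2 * (1 - m) ≤ Real.sqrt ((2 * (1 - m)) ^ 2) := by
    rw [Real.sqrt_sq_eq_abs]; exact le_abs_self _
  have h2 : Real.sqrt ((2 * (1 - m)) ^ 2) ≤ Real.sqrt ((∫ x, p x / q x * p x ∂μ) - 1) :=
    Real.sqrt_le_sqrt (by linarith)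
  linarith

/-- **THE OVERLAP-VS-ESS ENVELOPE ON A GENERAL SPACE**:
`max(min(κ, 1/2), 1 − ½√(1/κ − 1)) ≤ ∫ min(p, q) = 1 − TV(p, q)` with `κ = 1/W` — both sharp
pieces of row 3's finite `overlap_envelope` (`Scaling/OverlapEssFloor.lean`), for every measure
space; dominates row 2's `κ/(1 + κ)` (`overlap_ge_of_weightMoment`) everywhere. -/
theorem overlap_envelope_integral (hp0 : ∀ x, 0 < p x) (hpm : Measurable p)
    (hpi : Integrable p μ) (hp1 : ∫ x, p x ∂μ = 1) (hq0 : ∀ x, 0 < q x) (hqm : Measurable q)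
    (hqi : Integrable q μ) (hq1 : ∫ x, q x ∂μ = 1) (hW : Integrable (fun x => p x / q x * p x) μ) :
    max (min (1 / ∫ x, p x / q x * p x ∂μ) (1 / 2))
        (1 - Real.sqrt ((∫ x, p x / q x * p x ∂μ) - 1) / 2) ≤ ∫ x, min (p x) (q x) ∂μ :=
  max_le (min_inv_weightMoment_half_le_overlap hp0 hpm hpi hp1 hq0 hqm hqi hW)
    (one_sub_half_sqrt_le_overlap hpi hp1 hq0 hqi hq1 hW)

end General

/-! ### The lattice: row 2's φ⁴ flow sampler -/

section Lattice

open Summit.Ventures.LatticeQCDFlow.Scoring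

variable {n : ℕ}

/-- **OVERLAP ENVELOPE FOR THE φ⁴ FLOW SAMPLER**: `λ > 0`, any real `J`, positive measurable
model density `q̃` with `∫ q̃ = 1`; with `p = e^{−S}/Z` and `W = ∫ (p/q̃) p = 1/κ` finite:
`max(min(κ, 1/2), 1 − ½√(1/κ − 1)) ≤ ∫ min(p, q̃) = 1 − TV(π, q̃)`. -/
theorem phi4Flow_overlap_envelope {lam : ℝ} (hlam : 0 < lam)
    (J : Fin (n + 1) → Fin (n + 1) → ℝ) {q : (Fin (n + 1) → ℝ) → ℝ} (hq0 : ∀ φ, 0 < q φ)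
    (hqm : Measurable q) (hqi : Integrable q) (hq1 : ∫ φ, q φ = 1)
    (hW : Integrable (fun φ => (gibbsWeight J lam φ / gibbsZ J lam) / q φ
      * (gibbsWeight J lam φ / gibbsZ J lam))) :
    max (min (1 / ∫ φ, (gibbsWeight J lam φ / gibbsZ J lam) / q φ
            * (gibbsWeight J lam φ / gibbsZ J lam)) (1 / 2))
        (1 - Real.sqrt ((∫ φ, (gibbsWeight J lam φ / gibbsZ J lam) / q φ
            * (gibbsWeight J lam φ / gibbsZ J lam)) - 1) / 2)
      ≤ ∫ φ, min (gibbsWeight J lam φ / gibbsZ J lam) (q φ) := by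
  have hZ := gibbsZ_pos hlam J
  have hp0 : ∀ φ, 0 < gibbsWeight J lam φ / gibbsZ J lam := fun φ =>
    div_pos (gibbsWeight_pos J lam φ) hZ
  have hpm : Measurable fun φ => gibbsWeight J lam φ / gibbsZ J lam :=
    (continuous_gibbsWeight J lam).measurable.div_const _
  have hpi : Integrable fun φ => gibbsWeight J lam φ / gibbsZ J lam :=
    (integrable_gibbsWeight hlam J).div_const _
  have hp1 : ∫ φ, gibbsWeight J lam φ / gibbsZ J lam = 1 := by
    rw [integral_div]
    unfold gibbsZ
    exact div_self (by unfold gibbsZ at hZ; exact hZ.ne')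
  exact overlap_envelope_integral (μ := volume) hp0 hpm hpi hp1 hq0 hqm hqi hq1 hW

end Lattice

end Summit.Ventures.LatticeQCDFlow.Theory2
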